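import Summits.AtomisticToContinuum.HydrodynamicLimit.Theses.JParityClosure
import Literature.MathematicalPhysics.KineticTheory.EvenCollisionTubeFunctional
import Literature.MathematicalPhysics.KineticTheory.MicroscaleWindowFunctionals
import Literature.MathematicalPhysics.KineticTheory.EvenStatTruncationBound
import Summits.AtomisticToContinuum.HydrodynamicLimit.Theorems.JParityClosureEvenStressEnskogLocalGibbsReduction
import Summits.AtomisticToContinuum.HydrodynamicLimit.Theorems.JParityClosureEvenStressEnskogValueFree
import HarnessLib

/-!
# Rung 0 of the two pre-shock children of `EvenStressEnskog` (line `preshock-kinetic-slaving`,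
# crux `JParityClosure.EvenStressEnskog`, stmt-AtomisticToContinuum-13079 — lead c7, S2 partial (a))

The planners' recommended restatement-and-split of the crux is
`EvenStressEnskogPreShock ⇐ ContactEvenPreShock ∧ VelocityEquilibrationPreShock` (pre-shock, LLN-tied frame;
`Cruxes/EvenStressEnskog/STRATEGY-CENSUS.md`, `Lines/preshock_kinetic_slaving.lean`).  At GLOBAL EQUILIBRIUM
(constant profiles `a, u, θ`) the Euler-solution / `t = 0`-LLN hypotheses of that frame are idle and the two children
become untied rung-0 statements.  This definition-free file records how they follow from ONE input, the rung-0
one-body statement (L1)₀ = the registered stub `stub_velocityEquilibrationRung0` of the line (spelled out as the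
hypothesis `hL1`):

* `enskogSideRung0_of_velocityEquilibrationRung0` — (L1)₀ ⇒ the ENSKOG SIDE at rung 0 (the fully Maxwellian
  prediction `contactPredM` is close to the crux's own empirical Enskog term `σ³∫₀^τ enskogRate`), by the landed exact
  identification identity `contactPredM_sub_enskog_eq_oneBodyPred_sub_oneBodyStat` (p134407) with the pointwise
  second-moment identity `stub_enskogPointwise` (p127996) and the analytic clamp of the contact value
  (`exists_contactValue_clamp`), exactly as in the ∀τ / pre-shock versions;
* `contactSideRung0_of_enskogSideRung0` — the Enskog side at rung 0 and the crux AT RUNG 0 (`evenStressEnskog_rung0`,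
  p121729, UNCONDITIONAL) give the CONTACT SIDE at rung 0 (`collisionSum ≈ contactPredM` for the six even marks), by
  the union bound `{η < |K − C|} ⊆ {η/2 < |K − E|} ∪ {η/2 < |C − E|}`;
* `contactSideRung0_of_velocityEquilibrationRung0` — the composition: (L1)₀ ⇒ `ContactEvenPreShock` at rung 0.

So the moment `stub_velocityEquilibrationRung0` lands, BOTH future children are closed at rung 0 by one-line
instantiations (appended then).  References: Chapman–Cowling (1970) Ch. 16; Spohn (1991) Part I §3.2;
van Beijeren–Ernst (1973).
-/

noncomputable section

namespace Summit.AtomisticToContinuum.HydrodynamicLimit.Theorems.EvenStressEnskog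

open scoped BigOperators InnerProductSpace Topology ENNReal
open MeasureTheory Filter Set
open Literature.MathematicalPhysics.KineticTheory Literature.Analysis.FluidPDE
open Literature.MathematicalPhysics.KineticTheory.StationaryMicroscale
open Summit.AtomisticToContinuum.HydrodynamicLimit.Theses.JParityClosure

/-- **(L1)₀ ⇒ ENSKOG SIDE AT RUNG 0.**  Hypothesis `hL1` is, verbatim, the registered stub
`stub_velocityEquilibrationRung0` of the line `preshock-kinetic-slaving` (one-body `r`-scale statistic of every
continuous quadratic-growth `F(v, u_r, θ_r)` ≈ its local-Maxwellian prediction, in probability under the local Gibbs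
law with constant profiles).  Conclusion: `contactPredM ≈ σ³∫₀^τ enskogRate ∘ Φ_s` for the six even marks, same
frame.  Proof: (L1)₀ applied to the weight `g·Ỹ·a` (`Ỹ` the analytic clamp of `contactValue`,
`exists_contactValue_clamp`, `η₀ := min η₀^{(L1)} η_Y`) and the test functions
`F_{kl} = ∫_{S²}⟪v − u, ω⟫² ω_k ω_l dσ`; on good configurations the two differences agree EXACTLY
(`contactPredM_sub_enskog_eq_oneBodyPred_sub_oneBodyStat`), the bad set is null (`localGibbsLaw_compl_good`).
[folklore] -/
theorem enskogSideRung0_of_velocityEquilibrationRung0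
    (hL1 : ∃ η₀ : ℝ, 0 < η₀ ∧ ∀ (a θ : ℝ) (u : V3), 0 < a → 0 < θ → ∃ σ₀ : ℝ, 0 < σ₀ ∧ ∀ σ : ℝ, 0 < σ → σ < σ₀ →
      ∀ Φ : (N : ℕ) → HardSphereFlow (Torus.geometry (Fin 3)) (hsDiameter σ N) (N + 1),
      ∀ τ : ℝ, 0 < τ →
      ∀ χ : ℝ × T3 → ℝ, Continuous χ → ∀ k : ℝ → ℝ, Continuous k → (∀ b, η₀ ≤ b → k b = 0) →
      ∀ F : V3 × V3 × ℝ → ℝ, Continuous F →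
      (∃ C : ℝ, ∀ q, |F q| ≤ C * (1 + ‖q.1‖ ^ 2 + ‖q.2.1‖ ^ 2 + |q.2.2|)) →
      ∀ η δ : ℝ, 0 < η → 0 < δ → ∃ r₀ : ℝ, 0 < r₀ ∧ ∀ r : ℝ, 0 < r → r < r₀ → ∃ N₀ : ℕ, ∀ N : ℕ, N₀ ≤ N →
        localGibbsLaw σ (fun _ => a) (fun _ => u) (fun _ => θ) N (Φ N)
          {z | η < |oneBodyStat σ N (Φ N) τ χ k F r z - oneBodyPred σ N (Φ N) τ χ k F r z|}
          ≤ ENNReal.ofReal δ) :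
    ∃ η₀ : ℝ, 0 < η₀ ∧ ∀ (a θ : ℝ) (u : V3), 0 < a → 0 < θ → ∃ σ₀ : ℝ, 0 < σ₀ ∧ ∀ σ : ℝ, 0 < σ → σ < σ₀ →
      ∀ Φ : (N : ℕ) → HardSphereFlow (Torus.geometry (Fin 3)) (hsDiameter σ N) (N + 1), ∀ τ : ℝ, 0 < τ →
      ∀ χ : ℝ × T3 → ℝ, Continuous χ → ∀ g : ℝ → ℝ, Continuous g → (∀ a, η₀ ≤ a → g a = 0) →
      ∀ k l : Fin 3,
      ∀ η δ : ℝ, 0 < η → 0 < δ → ∃ r₀ : ℝ, 0 < r₀ ∧ ∀ r : ℝ, 0 < r → r < r₀ → ∃ N₀ : ℕ, ∀ N : ℕ, N₀ ≤ N →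
        localGibbsLaw σ (fun _ => a) (fun _ => u) (fun _ => θ) N (Φ N)
          {z | η < |contactPredM σ N (Φ N) τ χ g (evenMark k l) r z
                - σ ^ 3 * ∫ s in Set.Icc (0 : ℝ) τ, enskogRate σ N χ g (evenMark k l) r s ((Φ N).flow s z)|}
          ≤ ENNReal.ofReal δ := by
  obtain ⟨η₁, hη₁, H1⟩ := hL1
  obtain ⟨ηY, hηY, Yt, hYt, hYeq⟩ := exists_contactValue_clamp
  refine ⟨min η₁ ηY, lt_min hη₁ hηY, ?_⟩
  intro a θ u ha hθ
  obtain ⟨σ₀, hσ₀, H2⟩ := H1 a θ u ha hθ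
  refine ⟨σ₀, hσ₀, ?_⟩
  intro σ hσ hσlt Φ τ hτ χ hχ g hg hg0 k l η δ hη hδ
  have hg0' : ∀ a, η₁ ≤ a → g a = 0 := fun a ha => hg0 a ((min_le_left _ _).trans ha)
  have hkc : Continuous fun a => g a * Yt a * a := weight_continuous hg hYt
  have hk0 : ∀ a, η₁ ≤ a → g a * Yt a * a = 0 := weight_eq_zero_of_le hg0'
  obtain ⟨r₀, hr₀, H3⟩ := H2 σ hσ hσlt Φ τ hτ χ hχ (fun a => g a * Yt a * a) hkc hk0
    (fun q : V3 × V3 × ℝ => ∫ ω : Metric.sphere (0 : V3) 1,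
      ⟪q.1 - q.2.1, (ω : V3)⟫_ℝ ^ 2 * ((ω : V3) k * (ω : V3) l) ∂sphereMeasure)
    (continuous_secondMomentTest k l) (exists_abs_secondMomentTest_le k l) η δ hη hδ
  refine ⟨r₀, hr₀, fun r hr hrr => ?_⟩
  obtain ⟨N₀, H4⟩ := H3 r hr hrr
  refine ⟨N₀, fun N hN => ?_⟩
  obtain ⟨Ck, -, hkb⟩ := exists_bound_of_eq_zero_of_le hkc hη₁ hk0
  obtain ⟨CgY, -, hgY⟩ :=
    exists_bound_mul_contactValue_of_clamp hg hYt hYeq (lt_min hη₁ hηY) (min_le_right _ _) hg0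
  have hkw : ∀ a, 0 ≤ a → g a * contactValue a * a = g a * Yt a * a := fun a ha =>
    mul_contactValue_mul_eq_weight hYeq (min_le_right _ _) hg0 ha
  refine (measure_le_of_subset_union_null (localGibbsLaw σ (fun _ => a) (fun _ => u) (fun _ => θ) N (Φ N))
    (localGibbsLaw_compl_good (Φ N)) fun z hz => ?_).trans (H4 N hN)
  by_cases hzg : z ∈ (Φ N).good
  · refine Set.mem_union_left _ ?_
    rw [mem_setOf_eq] at hz ⊢
    rw [contactPredM_sub_enskog_eq_oneBodyPred_sub_oneBodyStat hσ.le (Φ N) hzg hr τ hχ hg hgY hkc hkb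
      hkw (continuous_sphereMark_uncurry (continuous_evenMark k l)).measurable
      (abs_sphereMark_evenMark_le' k l) (continuous_secondMomentTest k l)
      (CF := sphereMeasure.real (univ : Set (Metric.sphere (0 : V3) 1))) measureReal_nonneg
      (fun v u _ => abs_secondMomentTest_le k l v u) (fun w x => stub_enskogPointwise N k l r hr w x),
      abs_sub_comm] at hz
    exact hz
  · exact Set.mem_union_right _ (Set.mem_compl hzg)

/-- **ENSKOG SIDE AT RUNG 0 + THE CRUX AT RUNG 0 ⇒ CONTACT SIDE AT RUNG 0.**  The crux at constant profiles is the
unconditional theorem `evenStressEnskog_rung0` (p121729: `evenStat = collisionSum − σ³∫enskogRate` small in probability);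
with the Enskog side at rung 0 (`hE0`) the union bound `{η < |K − C|} ⊆ {η/2 < |K − E|} ∪ {η/2 < |C − E|}` pair by
pair gives the contact side `collisionSum ≈ contactPredM` at rung 0 — i.e. the rung 0 of the planners' crux child
`ContactEvenPreShock`. [folklore] -/
theorem contactSideRung0_of_enskogSideRung0
    (hE0 : ∃ η₀ : ℝ, 0 < η₀ ∧ ∀ (a θ : ℝ) (u : V3), 0 < a → 0 < θ → ∃ σ₀ : ℝ, 0 < σ₀ ∧ ∀ σ : ℝ, 0 < σ → σ < σ₀ →
      ∀ Φ : (N : ℕ) → HardSphereFlow (Torus.geometry (Fin 3)) (hsDiameter σ N) (N + 1), ∀ τ : ℝ, 0 < τ →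
      ∀ χ : ℝ × T3 → ℝ, Continuous χ → ∀ g : ℝ → ℝ, Continuous g → (∀ a, η₀ ≤ a → g a = 0) →
      ∀ k l : Fin 3,
      ∀ η δ : ℝ, 0 < η → 0 < δ → ∃ r₀ : ℝ, 0 < r₀ ∧ ∀ r : ℝ, 0 < r → r < r₀ → ∃ N₀ : ℕ, ∀ N : ℕ, N₀ ≤ N →
        localGibbsLaw σ (fun _ => a) (fun _ => u) (fun _ => θ) N (Φ N)
          {z | η < |contactPredM σ N (Φ N) τ χ g (evenMark k l) r z
                - σ ^ 3 * ∫ s in Set.Icc (0 : ℝ) τ, enskogRate σ N χ g (evenMark k l) r s ((Φ N).flow s z)|}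
          ≤ ENNReal.ofReal δ) :
    ∃ η₀ : ℝ, 0 < η₀ ∧ ∀ (a θ : ℝ) (u : V3), 0 < a → 0 < θ → ∃ σ₀ : ℝ, 0 < σ₀ ∧ ∀ σ : ℝ, 0 < σ → σ < σ₀ →
      ∀ Φ : (N : ℕ) → HardSphereFlow (Torus.geometry (Fin 3)) (hsDiameter σ N) (N + 1), ∀ τ : ℝ, 0 < τ →
      ∀ χ : ℝ × T3 → ℝ, Continuous χ → ∀ g : ℝ → ℝ, Continuous g → (∀ a, η₀ ≤ a → g a = 0) →
      ∀ k l : Fin 3,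
      ∀ η δ : ℝ, 0 < η → 0 < δ → ∃ r₀ : ℝ, 0 < r₀ ∧ ∀ r : ℝ, 0 < r → r < r₀ → ∃ N₀ : ℕ, ∀ N : ℕ, N₀ ≤ N →
        localGibbsLaw σ (fun _ => a) (fun _ => u) (fun _ => θ) N (Φ N)
          {z | η < |collisionSum σ N (Φ N) τ χ g (evenMark k l) r z - contactPredM σ N (Φ N) τ χ g (evenMark k l) r z|}
          ≤ ENNReal.ofReal δ := by
  obtain ⟨η₄, hη₄, H4⟩ := evenStressEnskog_rung0
  obtain ⟨η₅, hη₅, H5⟩ := hE0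
  refine ⟨min η₄ η₅, lt_min hη₄ hη₅, ?_⟩
  intro a θ u ha hθ
  obtain ⟨σ₄, hσ₄, H4⟩ := H4 a θ u ha hθ
  obtain ⟨σ₅, hσ₅, H5⟩ := H5 a θ u ha hθ
  refine ⟨min σ₄ σ₅, lt_min hσ₄ hσ₅, ?_⟩
  intro σ hσ hσlt Φ τ hτ χ hχ g hg hg0 k l η δ hη hδ
  have hσ4 : σ < σ₄ := lt_of_lt_of_le hσlt (min_le_left _ _)
  have hσ5 : σ < σ₅ := lt_of_lt_of_le hσlt (min_le_right _ _)
  have hg4 : ∀ a, η₄ ≤ a → g a = 0 := fun a h => hg0 a ((min_le_left _ _).trans h)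
  have hg5 : ∀ a, η₅ ≤ a → g a = 0 := fun a h => hg0 a ((min_le_right _ _).trans h)
  have hη2 : 0 < η / 2 := by positivity
  have hδ2 : 0 < δ / 2 := by positivity
  obtain ⟨r₄, hr₄, H4'⟩ := H4 σ hσ hσ4 Φ τ hτ χ hχ g hg hg4 (η / 2) (δ / 2) hη2 hδ2
  obtain ⟨r₅, hr₅, H5'⟩ := H5 σ hσ hσ5 Φ τ hτ χ hχ g hg hg5 k l (η / 2) (δ / 2) hη2 hδ2
  refine ⟨min r₄ r₅, lt_min hr₄ hr₅, fun r hr hrlt => ?_⟩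
  have hr4 : r < r₄ := lt_of_lt_of_le hrlt (min_le_left _ _)
  have hr5 : r < r₅ := lt_of_lt_of_le hrlt (min_le_right _ _)
  obtain ⟨N₄, H4''⟩ := H4' r hr hr4
  obtain ⟨N₅, H5''⟩ := H5' r hr hr5
  refine ⟨max N₄ N₅, fun N hN => ?_⟩
  have E4 := H4'' N ((le_max_left _ _).trans hN) k l
  have E5 := H5'' N ((le_max_right _ _).trans hN)
  set P := localGibbsLaw σ (fun _ => a) (fun _ => u) (fun _ => θ) N (Φ N)
  set K := fun z => collisionSum σ N (Φ N) τ χ g (evenMark k l) r z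
  set C := fun z => contactPredM σ N (Φ N) τ χ g (evenMark k l) r z
  set E := fun z => σ ^ 3 * ∫ s in Set.Icc (0 : ℝ) τ, enskogRate σ N χ g (evenMark k l) r s ((Φ N).flow s z)
  have hD : ∀ z, evenStat σ N (Φ N) τ χ g (evenMark k l) r z = K z - E z := fun z => rfl
  have hsub : {z | η < |K z - C z|} ⊆ {z | η / 2 < |evenStat σ N (Φ N) τ χ g (evenMark k l) r z|}
      ∪ {z | η / 2 < |C z - E z|} := by
    intro z hz
    simp only [Set.mem_setOf_eq, Set.mem_union] at hz ⊢
    rw [hD z]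
    by_contra hcon
    simp only [not_or, not_lt] at hcon
    obtain ⟨h1', h2'⟩ := hcon
    have : |K z - C z| ≤ |K z - E z| + |C z - E z| := by
      have := abs_sub_le (K z) (E z) (C z)
      rwa [abs_sub_comm (E z) (C z)] at this
    linarith
  calc P {z | η < |K z - C z|}
      ≤ P ({z | η / 2 < |evenStat σ N (Φ N) τ χ g (evenMark k l) r z|} ∪ {z | η / 2 < |C z - E z|}) :=
        measure_mono hsub
    _ ≤ P {z | η / 2 < |evenStat σ N (Φ N) τ χ g (evenMark k l) r z|} + P {z | η / 2 < |C z - E z|} :=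
        measure_union_le _ _
    _ ≤ ENNReal.ofReal (δ / 2) + ENNReal.ofReal (δ / 2) := add_le_add E4 E5
    _ = ENNReal.ofReal δ := by
        rw [← ENNReal.ofReal_add hδ2.le hδ2.le]
        congr 1
        ring

/-- **(L1)₀ ⇒ CONTACT SIDE AT RUNG 0** — the composition of the two theorems above: the rung-0 one-body statement
(the registered stub `stub_velocityEquilibrationRung0`, spelled out) gives the rung 0 of the planners' crux child
`ContactEvenPreShock` (pre-collisional even contact law = Enskog's, fully Maxwellian, at global equilibrium), the crux at
rung 0 being unconditional. [folklore] -/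
theorem contactSideRung0_of_velocityEquilibrationRung0 :
    (∃ η₀ : ℝ, 0 < η₀ ∧ ∀ (a θ : ℝ) (u : V3), 0 < a → 0 < θ → ∃ σ₀ : ℝ, 0 < σ₀ ∧ ∀ σ : ℝ, 0 < σ → σ < σ₀ →
      ∀ Φ : (N : ℕ) → HardSphereFlow (Torus.geometry (Fin 3)) (hsDiameter σ N) (N + 1),
      ∀ τ : ℝ, 0 < τ →
      ∀ χ : ℝ × T3 → ℝ, Continuous χ → ∀ k : ℝ → ℝ, Continuous k → (∀ b, η₀ ≤ b → k b = 0) →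
      ∀ F : V3 × V3 × ℝ → ℝ, Continuous F →
      (∃ C : ℝ, ∀ q, |F q| ≤ C * (1 + ‖q.1‖ ^ 2 + ‖q.2.1‖ ^ 2 + |q.2.2|)) →
      ∀ η δ : ℝ, 0 < η → 0 < δ → ∃ r₀ : ℝ, 0 < r₀ ∧ ∀ r : ℝ, 0 < r → r < r₀ → ∃ N₀ : ℕ, ∀ N : ℕ, N₀ ≤ N →
        localGibbsLaw σ (fun _ => a) (fun _ => u) (fun _ => θ) N (Φ N)
          {z | η < |oneBodyStat σ N (Φ N) τ χ k F r z - oneBodyPred σ N (Φ N) τ χ k F r z|}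
          ≤ ENNReal.ofReal δ) →
    ∃ η₀ : ℝ, 0 < η₀ ∧ ∀ (a θ : ℝ) (u : V3), 0 < a → 0 < θ → ∃ σ₀ : ℝ, 0 < σ₀ ∧ ∀ σ : ℝ, 0 < σ → σ < σ₀ →
      ∀ Φ : (N : ℕ) → HardSphereFlow (Torus.geometry (Fin 3)) (hsDiameter σ N) (N + 1), ∀ τ : ℝ, 0 < τ →
      ∀ χ : ℝ × T3 → ℝ, Continuous χ → ∀ g : ℝ → ℝ, Continuous g → (∀ a, η₀ ≤ a → g a = 0) →
      ∀ k l : Fin 3,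
      ∀ η δ : ℝ, 0 < η → 0 < δ → ∃ r₀ : ℝ, 0 < r₀ ∧ ∀ r : ℝ, 0 < r → r < r₀ → ∃ N₀ : ℕ, ∀ N : ℕ, N₀ ≤ N →
        localGibbsLaw σ (fun _ => a) (fun _ => u) (fun _ => θ) N (Φ N)
          {z | η < |collisionSum σ N (Φ N) τ χ g (evenMark k l) r z - contactPredM σ N (Φ N) τ χ g (evenMark k l) r z|}
          ≤ ENNReal.ofReal δ :=
  fun hL1 => contactSideRung0_of_enskogSideRung0 (enskogSideRung0_of_velocityEquilibrationRung0 hL1)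

end Summit.AtomisticToContinuum.HydrodynamicLimit.Theorems.EvenStressEnskog

end
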